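import Mathlib
import HarnessLib
import Summits.QuantumFields.YangMills.Theorems.MirrorModularBoostsHypercubicLimitPlaneLimitsDefs
import Summits.QuantumFields.YangMills.Theorems.LangevinControlUVOSLegsFromFemtoAndGapStubAssemblyStrings
import Summits.QuantumFields.YangMills.Theorems.LangevinControlUVOSLegsFromFemtoAndGapStubAssemblyInheritance
import Literature.MathematicalPhysics.QuantumFieldTheory.SchwingerLimitInheritance
import Literature.MathematicalPhysics.QuantumFieldTheory.LatticeGaugeProofs

/-!
# Line `Sketch` (coupling response), closure step Z3a: E0 (normalisation) and E3 of the summed plane-string limits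

Crux `stmt-QuantumFields-16154` (`HypercubicLimit`), line `Sketch`, reshape 4.  Sub-goal
`planeSum_isNormalized_isSymmetric`: along a `PlaneLimits r sch φ T` package the candidate one-field family
`planeSum T = Σ_q T n q` is the pointwise limit on `⁰𝒮` of the summed renormalised plane-string lattice distributions
`j ↦ (n ↦ Σ_q planeDist r sch (φ j) n q)` (`PlaneLimits.tendsto_planeSum`), and each of these lattice families is
EXACTLY normalised (arity `0`: one string, scalar factor `1`, the empty torus moment of a probability measure is `1`)
and EXACTLY symmetric (a permutation of the arguments sends the string `q` to the reindexed string `q ∘ π`,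
`latticeDistStr_permTest`, and the sum over all strings is reindexed).  The tree's inheritance theorems
`isNormalized_of_tendsto` / `isSymmetric_of_tendsto` (`Literature/…/SchwingerLimitInheritance.lean`) transfer both
properties to the limit.  No physics.
-/

noncomputable section

open scoped SchwartzMap BigOperators
open MeasureTheory Filter Topology
open Literature.MathematicalPhysics.AQFT Literature.MathematicalPhysics.QuantumLattice
open Literature.MathematicalPhysics.QuantumFieldTheory
open Literature.Probability.LatticeModels (box Site)
open Summit.QuantumFields.YangMills.Theorems.OSLegsFromFemtoAndGap

namespace Summit.QuantumFields.YangMills.Cruxes.HypercubicLimit.CouplingResponse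

section LatticeFacts

variable {G : Type} [Group G] [TopologicalSpace G] [IsTopologicalGroup G] [CompactSpace G]
  [MeasurableSpace G] [BorelSpace G]

/-- **E0 on the lattice, exactly**: at arity `0` every renormalised plane-string distribution is evaluation at the
empty configuration (the scalar factor is `(c a⁴)⁰ = 1`, the string of observables over `Fin 0` is the constant
string, and the zero-point lattice distribution is evaluation, `latticeDist_zero_apply`). [folklore] -/
theorem planeDist_zero_apply (r : LatticeRep G) (sch : SpeciesScheme (YMSpecies G)) (k : ℕ) (q : Fin 0 → Plane)
    (F : 𝓢((Fin 0 → EuclideanSpace ℝ (Fin 4)), ℂ)) : planeDist r sch k 0 q F = F default := by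
  have hO : (fun i : Fin 0 => (planeSpecies r (q i)).F) = fun _ _ => (0 : ℝ) := Subsingleton.elim _ _
  simp only [planeDist, pow_zero, Complex.ofReal_one, one_smul, hO]
  exact latticeDist_zero_apply r.ρ r.continuous (sch.β k) (sch.L k) (sch.a k) (fun _ => (0 : ℝ))
    (sch.m r.curvature k / 6) F

/-- **E3 on the lattice, string by string**: permuting the arguments of the test function sends the renormalised
distribution of the plane string `q` to that of the reindexed string `q ∘ π` (`latticeDistStr_permTest`; the scalar
factor and the counterterms do not depend on the string). [folklore] -/
theorem planeDist_permTest (r : LatticeRep G) (sch : SpeciesScheme (YMSpecies G)) (k n : ℕ) (q : Fin n → Plane)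
    (π : Equiv.Perm (Fin n)) (F : 𝓢((Fin n → EuclideanSpace ℝ (Fin 4)), ℂ)) :
    planeDist r sch k n q (permTest π F) = planeDist r sch k n (q ∘ π) F := by
  simp only [planeDist, FunLike.coe_smul, Pi.smul_apply]
  rw [latticeDistStr_permTest]
  rfl

/-- **E3 on the lattice for the summed plane strings, exactly**: the sum over all strings `q : Fin n → Plane` of the
renormalised plane-string distributions is invariant under permutations of the arguments (reindex the sum by the
bijection `q ↦ q ∘ π`). [folklore] -/
theorem sum_planeDist_permTest (r : LatticeRep G) (sch : SpeciesScheme (YMSpecies G)) (k n : ℕ)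
    (π : Equiv.Perm (Fin n)) (F : 𝓢((Fin n → EuclideanSpace ℝ (Fin 4)), ℂ)) :
    ∑ q : Fin n → Plane, planeDist r sch k n q (permTest π F) = ∑ q : Fin n → Plane, planeDist r sch k n q F := by
  simp_rw [planeDist_permTest]
  exact (π.bijective.comp_right (γ := Plane)).sum_comp fun q : Fin n → Plane => planeDist r sch k n q F

/-- The summed plane-string lattice family at step `k`, `n ↦ Σ_q planeDist r sch k n q`, is exactly normalised. [folklore] -/
theorem isNormalized_sum_planeDist (r : LatticeRep G) (sch : SpeciesScheme (YMSpecies G)) (k : ℕ) :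
    (SchwingerFamily.toLabelled (E := EuclideanSpace ℝ (Fin 4))
      fun n => ∑ q : Fin n → Plane, planeDist r sch k n q).IsNormalized := by
  intro l F
  simp only [SchwingerFamily.toLabelled_apply, FunLike.coe_sum, Finset.sum_apply]
  rw [Fintype.sum_unique]
  exact (planeDist_zero_apply r sch k _ F).trans (congrArg F (Subsingleton.elim _ _))

/-- The summed plane-string lattice family at step `k` is exactly symmetric (E3 on the lattice). [folklore] -/
theorem isSymmetric_sum_planeDist (r : LatticeRep G) (sch : SpeciesScheme (YMSpecies G)) (k : ℕ) :
    (SchwingerFamily.toLabelled (E := EuclideanSpace ℝ (Fin 4))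
      fun n => ∑ q : Fin n → Plane, planeDist r sch k n q).IsSymmetric := by
  intro n l π F _
  simp only [SchwingerFamily.toLabelled_apply, FunLike.coe_sum, Finset.sum_apply]
  exact sum_planeDist_permTest r sch k n π F

end LatticeFacts

/-- **Registered sub-goal `planeSum_isNormalized_isSymmetric` (line `Sketch`, Z3a).**  Along a `PlaneLimits` package the
candidate one-field family `planeSum T` is normalised (E0) and symmetric (E3): both properties hold exactly for the
summed plane-string lattice families and are inherited along pointwise limits on `⁰𝒮`
(`isNormalized_of_tendsto`, `isSymmetric_of_tendsto`). [folklore] -/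
theorem planeSum_isNormalized_isSymmetric : ∀ (G : Type) [Group G] [TopologicalSpace G] [IsTopologicalGroup G] [CompactSpace G] [MeasurableSpace G] [BorelSpace G] (r : LatticeRep G) (sch : SpeciesScheme (YMSpecies G)) (φ : ℕ → ℕ) (T : (n : ℕ) → (Fin n → Plane) → (𝓢((Fin n → EuclideanSpace ℝ (Fin 4)), ℂ) →L[ℂ] ℂ)), PlaneLimits r sch φ T → (planeSum T).toLabelled.IsNormalized ∧ (planeSum T).toLabelled.IsSymmetric := by
  intro G _ _ _ _ _ _ r sch φ T h
  -- the summed plane-string lattice families along `φ` converge to `planeSum T` on `⁰𝒮`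
  have hconv : ∀ (n : ℕ) (F : 𝓢((Fin n → EuclideanSpace ℝ (Fin 4)), ℂ)), IsOffDiagonal F →
      Tendsto (fun j => (fun n => ∑ q : Fin n → Plane, planeDist r sch (φ j) n q :
        SchwingerFamily (EuclideanSpace ℝ (Fin 4))) n F) atTop (𝓝 (planeSum T n F)) := by
    intro n F hF
    simp only [FunLike.coe_sum, Finset.sum_apply]
    exact h.tendsto_planeSum F hF
  exact ⟨isNormalized_of_tendsto hconv (Eventually.of_forall fun j => isNormalized_sum_planeDist r sch (φ j)),
    isSymmetric_of_tendsto hconv (Eventually.of_forall fun j => isSymmetric_sum_planeDist r sch (φ j))⟩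

end Summit.QuantumFields.YangMills.Cruxes.HypercubicLimit.CouplingResponse

end
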